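import Mathlib

/-!
# Sketch — first lemmas of the crux ideas for
`CapacityClassicality.HilbertIntegralOverconvergentIsCongruence` (stmt-Langlands-8485)

Hilbert modular forms / their q-expansions are not yet typable (definition request
`HilbertModularFormQExpansion`), so the genuinely Hilbert-side lemmas are recorded as docstrings
and their `d = 1` SHADOWS (over `ℚ`, in the exact Katz-surrogate vocabulary of the route item
`IntegralOverconvergentIsCongruence`) are stated as Props that elaborate against Mathlib.
-/

set_option linter.dupNamespace false

namespace Summit.Langlands.Langlands.Cruxes.HilbertIntegralOverconvergentIsCongruence.Sketch

open scoped MatrixGroups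

/-- **Idea `sturm-slope-engine`, first lemma, `d = 1` shadow (Sturm–Schwarz `p`-adic lemma at the
cusp).**  Data exactly as in `IntegralOverconvergentIsCongruence`: a Katz surrogate
`g_n = ∑_i ι⁻¹ coeff_n (c_i · E_{p-1}^{-i})` with `c_i` the `q`-expansion of a classical form of
weight `k + i(p-1)` on `Γ₁(N)` and `‖ι⁻¹ c_i‖ ≤ C p^{-ri}` (i.e. `g` is `r`-overconvergent and
bounded by `C` on the strict neighbourhood `{v(E_{p-1}) < r}`).  CLAIM: if `g` vanishes to order
`m` at `∞` then its leading coefficient is `p`-adically SMALL, with an exponent governed by the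
Sturm line: for every `M : ℕ` such that the Sturm bound of weight `k + M(p-1)` on `Γ₁(N)` is `< m`,
`‖g_m‖ ≤ C · p^{-rM}`.  (Proof sketch: `T := g·E^M − tail` is classical of weight `k+M(p-1)`, its
first `m` coefficients are `≤ C p^{-r(M+1)}`, integral Sturm (Sturm 1987 Thm 1, mod `𝔪` form) makes
all of them small.)  Asymptotically `M ≈ 12 m /((p-1)[SL₂(ℤ):Γ₁(N)])`, i.e. the gain per unit order
is `(r log p)/s_N`, the route's capacity number, obtained WITHOUT potential theory.  The Hilbert
version replaces Sturm 1987 by the Hilbert Sturm bound (Burgos Gil–Pacetti, arXiv:1310.6991 §5–6)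
and `E_{p-1}` by a lift of a power of the total Hasse invariant. -/
def SturmSchwarzShadowQ : Prop :=
  ∀ (p : ℕ) [Fact p.Prime] (hp : 5 ≤ p) (N : ℕ) [NeZero N] (k : ℤ) (ι : PadicAlgCl p ≃+* ℂ)
    (r C : ℝ) (c : ℕ → PowerSeries ℂ), 0 < r → 0 ≤ C →
    (∀ i : ℕ, ∃ F : ModularForm (CongruenceSubgroup.Gamma1 N) (k + i * (p - 1 : ℕ)),
        c i = UpperHalfPlane.qExpansion 1 ⇑F) →
    (∀ i n : ℕ, ‖ι.symm (PowerSeries.coeff n (c i))‖ ≤ C * (p : ℝ) ^ (-(r * i))) →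
    ∀ (g : ℕ → PadicAlgCl p),
    (∀ n : ℕ, HasSum (fun i : ℕ ↦ ι.symm (PowerSeries.coeff n (c i *
        ((UpperHalfPlane.qExpansion 1 ⇑(ModularForm.E (show 3 ≤ p - 1 by omega)))⁻¹) ^ i)))
        (g n)) →
    ∀ (m M : ℕ), (∀ n < m, g n = 0) →
      ((k + M * (p - 1 : ℕ)) * ((CongruenceSubgroup.Gamma1 N).index : ℤ)).toNat / 12 < m →
      ‖g m‖ ≤ C * (p : ℝ) ^ (-(r * M))

/-- **Idea `sturm-slope-engine`, what the shadow leans on: integral Sturm bound over `ℚ` in norm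
form** (Sturm 1987, Thm 1; the tree proves the characteristic-zero case
`Literature.NumberTheory.EllipticCurves.ModularForms.modularForm_eq_zero_of_qExpansion_coeff_eq_zero`).
For a classical form on `Γ₁(N)` whose `q`-expansion, read in `ℚ̄_p` through `ι⁻¹`, has its first
coefficients (up to the Sturm line) of norm `≤ B`, ALL coefficients have norm `≤ B`. -/
def IntegralSturmNormQ : Prop :=
  ∀ (p : ℕ) [Fact p.Prime] (N : ℕ) [NeZero N] (k : ℤ) (ι : PadicAlgCl p ≃+* ℂ)
    (F : ModularForm (CongruenceSubgroup.Gamma1 N) k) (B : ℝ),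
    (∀ n : ℕ, n ≤ (k * ((CongruenceSubgroup.Gamma1 N).index : ℤ)).toNat / 12 →
        ‖ι.symm (PowerSeries.coeff n (UpperHalfPlane.qExpansion 1 ⇑F))‖ ≤ B) →
    ∀ n : ℕ, ‖ι.symm (PowerSeries.coeff n (UpperHalfPlane.qExpansion 1 ⇑F))‖ ≤ B

/-- **Idea `csp-koecher-collapse`, first lemma (Serre 1970, Le problème des groupes de congruence
pour SL₂, Ann. of Math. 92, Thm 2 / Cor.): the congruence subgroup property for `SL₂` over the
ring of integers of a totally real field of degree `≥ 2`.**  Every finite-index subgroup of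
`SL₂(𝓞 F)` contains a principal congruence subgroup `ker (SL₂(𝓞 F) → SL₂(𝓞 F ⧸ 𝔪))`, `𝔪 ≠ 0`.
(False for `F = ℚ`; this is exactly why the `ℚ`-engine needs Calegari–Dimitrov–Tang and the
Hilbert engine does not.) -/
def CongruenceSubgroupPropertySL2 : Prop :=
  ∀ (F : Type) [Field F] [NumberField F] [NumberField.IsTotallyReal F],
    1 < Module.finrank ℚ F →
    ∀ H : Subgroup (Matrix.SpecialLinearGroup (Fin 2) (NumberField.RingOfIntegers F)),
      H.FiniteIndex →
      ∃ 𝔪 : Ideal (NumberField.RingOfIntegers F), 𝔪 ≠ ⊥ ∧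
        (Matrix.SpecialLinearGroup.map (Ideal.Quotient.mk 𝔪)).ker ≤ H

/-- Elementary group theory used with CSP: a group acting on a set, an element with FINITE orbit has
a finite-index stabiliser (applied to `Γ₁(𝔫)` permuting the finitely many conjugates of an
algebraic `g` over the Hilbert modular function field). -/
theorem finiteIndex_stabilizer_of_finite_orbit {G X : Type*} [Group G] [MulAction G X] (x : X)
    (h : (MulAction.orbit G x).Finite) : (MulAction.stabilizer G x).FiniteIndex := by
  rw [Subgroup.finiteIndex_iff, MulAction.index_stabilizer]
  exact ((Set.ncard_pos h).mpr ⟨x, MulAction.mem_orbit_self x⟩).ne'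

end Summit.Langlands.Langlands.Cruxes.HilbertIntegralOverconvergentIsCongruence.Sketch
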